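import Mathlib.AlgebraicGeometry.Morphisms.Separated
import Mathlib.AlgebraicGeometry.Morphisms.ClosedImmersion
import HarnessLib

/-!
# The graph of a morphism over a base: a closed immersion, the induced morphism of a graph-like closed subscheme, base change

Topic `Literature/AlgebraicGeometry/Morphisms`; namespace `Literature.AlgebraicGeometry.Morphisms`.  THEOREMS ONLY (no definition, no named
fact, no instance, no notation, no `sorry`); Mathlib-only imports; universe-polymorphic.

[GortzWedhorn2020, Def. 9.7 ∕ Prop. 9.9, Example 9.11]: for `S`-schemes `q : Y → S`, `p : X → S` with `p` SEPARATED and an `S`-morphism `φ : Y → X`, the graph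
`Γ_φ = (𝟙, φ) : Y → Y ×_S X` is a CLOSED immersion (a section of the separated projection `Y ×_S X → Y`, base change of the diagonal of `p`).  This is the
dictionary «`S`-morphisms `Y → X` ↔ closed subschemes `Γ ⊂ Y ×_S X` projecting isomorphically onto `Y`» behind the Hom-SCHEME `Hom_S(Y, X)` as an open piece of
`Hilb(Y ×_S X ∕ S)` ([MumfordFogartyKirwan1994] Ch. 0 §5 (c) (p. 23); [FGA] no. 221 §4.c) — cell hodgecm-mathlib, FLOOR 0, P1 sub-line F-4 layer 2, sub-stub (II-b), brick
(b3) of B-p20 (g14)'s census `CENSUS-F4-IIb-HomScheme`.  We state everything for an ABSTRACT product `P` with projections `prY`, `prX` (`IsPullback prY prX qT pT`), so that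
both Mathlib's `pullback qT pT` and a base change `(Y ×_S X) ×_S T` qualify, and we avoid any `def`: «a graph» is any `γ : YT ⟶ P` with `γ ≫ prY = 𝟙`.

* `isSeparated_fst_of_isPullback` — `prY` is separated when `pT` is;
* `isClosedImmersion_of_comp_fst_eq_id` — a SECTION `γ` of `prY` (`γ ≫ prY = 𝟙`) is a closed immersion (Mathlib `IsClosedImmersion.of_comp`); `exists_graph` — the
  graph of `φ` exists (`IsPullback.lift`), `graph_unique` — and is unique;
* `comp_snd_comp_eq_of_section` ∕ `isIso_…` bookkeeping: a morphism `γ : Γ ⟶ P` with `γ ≫ prY` an ISOMORPHISM is, up to that isomorphism, the graph of the `T`-morphism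
  `φ_γ := inv (γ ≫ prY) ≫ γ ≫ prX` (`eq_graph_of_isIso_comp_fst`, `comp_eq_of_isIso_comp_fst`);
* `eq_id_of_comp_graph_eq` ∕ `eq_of_comp_graph_eq` — two graphs with the same image are equal (a morphism `e` with `e ≫ γ₂ = γ₁` is the identity);
* BASE CHANGE along `w : T′ → T` (cartesian squares `κY`, `κX` over `w`, products `P′`, `P` with `κP`): `graph_comp_eq_comp_graph` (the graphs are intertwined by `κP`
  iff the morphisms are intertwined by `κX`, `comp_eq_comp_of_graph_comp`), `isPullback_prod_of_isPullback` (`P′ = Y′ ×_{Y_T} P`), and **`isPullback_graph`** — the graph of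
  the base-changed morphism is the BASE CHANGE of the graph (`IsPullback κY γ′ γ κP`, by pasting `IsPullback.of_right`).

HC_CM is proved only modulo the 7 printed citations until rung 0 closes; this file discharges none of them.

## References
* [GortzWedhorn2020] U. Görtz, T. Wedhorn, *Algebraic Geometry I*, 2nd ed. (2020), Definition 9.7 and Proposition 9.9 (separated ⇔ diagonal closed; graphs),
  Example 9.11, Section (4.7) (base change).
* [MumfordFogartyKirwan1994] D. Mumford, J. Fogarty, F. Kirwan, *Geometric Invariant Theory*, 3rd ed. (1994), Ch. 0 §5 (c) (p. 23).
-/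

set_option autoImplicit false

universe u

open CategoryTheory CategoryTheory.Limits AlgebraicGeometry

namespace Literature.AlgebraicGeometry.Morphisms

variable {T YT XT P : Scheme.{u}} {qT : YT ⟶ T} {pT : XT ⟶ T} {prY : P ⟶ YT} {prX : P ⟶ XT}

/-! ### Graphs are closed immersions -/

/-- The projection `Y ×_T X → Y` is separated when `X → T` is (base change). [cite: GortzWedhorn2020, Proposition 9.9 and Section (4.7)] -/
theorem isSeparated_fst_of_isPullback (hP : IsPullback prY prX qT pT) [IsSeparated pT] : IsSeparated prY :=
  MorphismProperty.of_isPullback hP.flip ‹IsSeparated pT›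

/-- **A section of `Y ×_T X → Y` is a closed immersion** when `X → T` is separated: its composite with the separated `prY` is the identity,
a closed immersion, so Mathlib's `IsClosedImmersion.of_comp` applies.  In particular THE GRAPH `(𝟙, φ)` of a
`T`-morphism `φ : Y → X` is a closed immersion. [cite: GortzWedhorn2020, Definition 9.7 and Example 9.11] -/
theorem isClosedImmersion_of_comp_fst_eq_id (hP : IsPullback prY prX qT pT) [IsSeparated pT] (γ : YT ⟶ P)
    (hγ : γ ≫ prY = 𝟙 YT) : IsClosedImmersion γ := by
  haveI : IsSeparated prY := isSeparated_fst_of_isPullback hP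
  haveI : IsClosedImmersion (γ ≫ prY) := by rw [hγ]; infer_instance
  exact IsClosedImmersion.of_comp γ prY

/-- **The graph exists**: a `T`-morphism `φ : Y → X` has a graph `γ : Y → Y ×_T X`, `γ ≫ prY = 𝟙`, `γ ≫ prX = φ` (the universal property of
the product). [cite: GortzWedhorn2020, Definition 9.7] -/
theorem exists_graph (hP : IsPullback prY prX qT pT) (φ : YT ⟶ XT) (hφ : φ ≫ pT = qT) :
    ∃ γ : YT ⟶ P, γ ≫ prY = 𝟙 YT ∧ γ ≫ prX = φ :=
  ⟨hP.lift (𝟙 YT) φ (by rw [Category.id_comp, hφ]), hP.lift_fst _ _ _, hP.lift_snd _ _ _⟩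

/-- The graph is unique: two morphisms to `Y ×_T X` with the same two projections coincide. [cite: GortzWedhorn2020, Definition 9.7] -/
theorem graph_unique (hP : IsPullback prY prX qT pT) {γ₁ γ₂ : YT ⟶ P} (h₁ : γ₁ ≫ prY = γ₂ ≫ prY)
    (h₂ : γ₁ ≫ prX = γ₂ ≫ prX) : γ₁ = γ₂ :=
  hP.hom_ext h₁ h₂

/-- A section `γ` of `prY` is the graph of the `T`-MORPHISM `γ ≫ prX` (it lies over `T`). [cite: GortzWedhorn2020, Definition 9.7] -/
theorem comp_snd_comp_eq_of_section (hP : IsPullback prY prX qT pT) (γ : YT ⟶ P) (hγ : γ ≫ prY = 𝟙 YT) :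
    (γ ≫ prX) ≫ pT = qT := by
  rw [Category.assoc, ← hP.w, ← Category.assoc, hγ, Category.id_comp]

/-! ### Closed subschemes projecting isomorphically onto `Y` are graphs -/

/-- **A graph-like subscheme defines a `T`-morphism**: if `γ : Γ → Y ×_T X` has `γ ≫ prY` an isomorphism, then
`φ_γ := (γ ≫ prY)⁻¹ ≫ γ ≫ prX : Y → X` lies over `T`. [cite: GortzWedhorn2020, Definition 9.7 and Proposition 9.9] -/
theorem comp_eq_of_isIso_comp_fst (hP : IsPullback prY prX qT pT) {Γ : Scheme.{u}} (γ : Γ ⟶ P) [IsIso (γ ≫ prY)] :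
    (inv (γ ≫ prY) ≫ γ ≫ prX) ≫ pT = qT := by
  rw [Category.assoc, Category.assoc, ← hP.w, ← Category.assoc γ prY, IsIso.inv_hom_id_assoc]

/-- **… and `Γ` IS its graph up to the isomorphism `γ ≫ prY : Γ ≅ Y`**: `γ = (γ ≫ prY) ≫ γ_φ` where `γ_φ := (γ ≫ prY)⁻¹ ≫ γ` is a section of `prY` with
second projection `φ_γ`. [cite: GortzWedhorn2020, Definition 9.7 and Proposition 9.9] -/
theorem eq_graph_of_isIso_comp_fst {Γ : Scheme.{u}} (γ : Γ ⟶ P) [IsIso (γ ≫ prY)] :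
    (inv (γ ≫ prY) ≫ γ) ≫ prY = 𝟙 YT ∧ (inv (γ ≫ prY) ≫ γ) ≫ prX = inv (γ ≫ prY) ≫ γ ≫ prX ∧
      γ = (γ ≫ prY) ≫ (inv (γ ≫ prY) ≫ γ) := by
  refine ⟨by rw [Category.assoc, IsIso.inv_hom_id], by rw [Category.assoc], ?_⟩
  rw [← Category.assoc, IsIso.hom_inv_id, Category.id_comp]

/-- **Graphs with the same image coincide**: if `e : Y → Y` carries the section `γ₂` to the section `γ₁` (`e ≫ γ₂ = γ₁`), then `e = 𝟙`.
[cite: GortzWedhorn2020, Definition 9.7] -/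
theorem eq_id_of_comp_graph_eq {γ₁ γ₂ : YT ⟶ P} (h₁ : γ₁ ≫ prY = 𝟙 YT) (h₂ : γ₂ ≫ prY = 𝟙 YT) {e : YT ⟶ YT}
    (he : e ≫ γ₂ = γ₁) : e = 𝟙 YT := by
  have := congrArg (· ≫ prY) he
  simpa only [Category.assoc, h₂, Category.comp_id, h₁] using this

/-- **… hence the morphisms coincide**: `γ₁ ≫ prX = γ₂ ≫ prX` (and `γ₁ = γ₂`). [cite: GortzWedhorn2020, Definition 9.7] -/
theorem eq_of_comp_graph_eq {γ₁ γ₂ : YT ⟶ P} (h₁ : γ₁ ≫ prY = 𝟙 YT) (h₂ : γ₂ ≫ prY = 𝟙 YT) {e : YT ⟶ YT}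
    (he : e ≫ γ₂ = γ₁) : γ₁ = γ₂ ∧ γ₁ ≫ prX = γ₂ ≫ prX := by
  obtain rfl : e = 𝟙 YT := eq_id_of_comp_graph_eq h₁ h₂ he
  rw [Category.id_comp] at he
  exact ⟨he.symm, by rw [he]⟩

/-! ### Base change of graphs along `w : T′ → T` -/

section BaseChange

variable {T' YT' XT' P' : Scheme.{u}} {qT' : YT' ⟶ T'} {pT' : XT' ⟶ T'} {prY' : P' ⟶ YT'} {prX' : P' ⟶ XT'}
  {w : T' ⟶ T} {κY : YT' ⟶ YT} {κX : XT' ⟶ XT} {κP : P' ⟶ P}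

/-- **Graphs intertwine iff the morphisms do** (one direction): if the sections `γ′`, `γ` have second projections `φ′`, `φ` with `φ′ ≫ κX = κY ≫ φ`,
then `γ′ ≫ κP = κY ≫ γ` (for `κP` the map of products determined by `κY`, `κX`). [cite: GortzWedhorn2020, Section (4.7)] -/
theorem graph_comp_eq_comp_graph (hP : IsPullback prY prX qT pT) (hκY : κP ≫ prY = prY' ≫ κY) (hκX : κP ≫ prX = prX' ≫ κX)
    {γ' : YT' ⟶ P'} {γ : YT ⟶ P} (hγ' : γ' ≫ prY' = 𝟙 YT') (hγ : γ ≫ prY = 𝟙 YT)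
    (h : (γ' ≫ prX') ≫ κX = κY ≫ γ ≫ prX) : γ' ≫ κP = κY ≫ γ := by
  apply hP.hom_ext
  · rw [Category.assoc, hκY, ← Category.assoc, hγ', Category.id_comp, Category.assoc, hγ, Category.comp_id]
  · rw [Category.assoc, hκX, ← Category.assoc, h, Category.assoc]

/-- (The other direction.) If the graphs intertwine, `γ′ ≫ κP = κY ≫ γ`, then so do the morphisms: `φ′ ≫ κX = κY ≫ φ`.
[cite: GortzWedhorn2020, Section (4.7)] -/
theorem comp_eq_comp_of_graph_comp (hκX : κP ≫ prX = prX' ≫ κX) {γ' : YT' ⟶ P'} {γ : YT ⟶ P}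
    (h : γ' ≫ κP = κY ≫ γ) : (γ' ≫ prX') ≫ κX = κY ≫ γ ≫ prX := by
  rw [Category.assoc, ← hκX, ← Category.assoc, h, Category.assoc]

/-- **`P′ = Y′ ×_{Y} P`**: if `P′ = Y′ ×_{T′} X′`, `P = Y ×_T X` and `X′ = X ×_T T′`, `Y′ → Y` over `T′ → T`, then the comparison `κP` makes the square
`(κP, prY′; prY, κY)` cartesian (pasting). [cite: GortzWedhorn2020, Section (4.7)] -/
theorem isPullback_prod_of_isPullback (hP : IsPullback prY prX qT pT) (hP' : IsPullback prY' prX' qT' pT')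
    (hX : IsPullback κX pT' pT w) (hwY : κY ≫ qT = qT' ≫ w) (hκY : κP ≫ prY = prY' ≫ κY)
    (hκX : κP ≫ prX = prX' ≫ κX) : IsPullback κP prY' prY κY := by
  -- `P′ = Y′ ×_T X` (paste `P′ = Y′ ×_{T′} X′` with `X′ = T′ ×_T X`)
  have s : IsPullback (κP ≫ prX) prY' pT (κY ≫ qT) := by
    rw [hκX, hwY]; exact hP'.flip.paste_horiz hX
  exact IsPullback.of_right s hκY hP.flip

/-- **The graph of the base change is the base change of the graph**: with the data above and sections `γ′`, `γ` intertwined by `κP`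
(`γ′ ≫ κP = κY ≫ γ`), the square `(κY, γ′; γ, κP)` is CARTESIAN — so a closed subscheme `Γ_φ ⊂ Y ×_T X` pulls back, along `w`, to `Γ_{φ_{T′}}`.
[cite: GortzWedhorn2020, Section (4.7) and Definition 9.7] -/
theorem isPullback_graph (hP : IsPullback prY prX qT pT) (hP' : IsPullback prY' prX' qT' pT')
    (hX : IsPullback κX pT' pT w) (hwY : κY ≫ qT = qT' ≫ w) (hκY : κP ≫ prY = prY' ≫ κY)
    (hκX : κP ≫ prX = prX' ≫ κX) {γ' : YT' ⟶ P'} {γ : YT ⟶ P} (hγ' : γ' ≫ prY' = 𝟙 YT') (hγ : γ ≫ prY = 𝟙 YT)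
    (h : γ' ≫ κP = κY ≫ γ) : IsPullback κY γ' γ κP := by
  have t : IsPullback κP prY' prY κY := isPullback_prod_of_isPullback hP hP' hX hwY hκY hκX
  have s : IsPullback (γ' ≫ prY') κY κY (γ ≫ prY) := by
    rw [hγ', hγ]; exact IsPullback.of_horiz_isIso ⟨by rw [Category.id_comp, Category.comp_id]⟩
  exact (IsPullback.of_right s h t.flip).flip

end BaseChange

end Literature.AlgebraicGeometry.Morphisms
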